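import Literature.Algebra.Homology.AlternatingCochainEvaluation
import Literature.Algebra.Homology.PolyInfiniteCyclicCohomologyRank
import Mathlib.LinearAlgebra.Matrix.NonsingularInverse
import HarnessLib

/-!
# `H•(ℤ^d, k) = Λ•(k^d)`, equivariantly: eigenbases of product cocycles

Topic `Algebra/Homology`; namespace `Literature.Algebra.Homology`.  Definitions with bodies and
theorems; Mathlib + `ProductCocycles`, `AlternatingCochainEvaluation`,
`PolyInfiniteCyclicCohomologyRank`, `ScalarFiltration`.

Let `G` be a commutative group with a `ℤ`-basis `b₁, …, b_d` (every element is uniquely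
`∏ bᵢ^{mᵢ}`), `k` a field with the trivial action, and `θ₁, …, θ_d : G → k` linearly independent
additive characters.  Then:

* `zpowSpan b i` — the poly-ℤ chain `⟨b₁, …, bᵢ⟩`, and `finrank_groupCohomology_le_choose` —
  `dim Hⁿ(G, A) ≤ dim A · (d choose n)` (`PolyInfiniteCyclicCohomologyRank`);
* `isUnit_det_charMatrix` — the matrix `(θ_τ(b_j))` is invertible; `dualChar` — the dual characters
  `θ'ⱼ = ∑_τ (M⁻¹)_{jτ} θ_τ`, `θ'ⱼ(b_l) = δ_{jl}` (`dualChar_apply_basis`);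
* `linearIndependent_prodClass_dual` — the `(d choose n)` classes `[θ'_{s}] = [θ'_{s₁} ∪ ⋯ ∪ θ'_{sₙ}]`,
  `s` an `n`-subset, are linearly independent in `Hⁿ(G, k)` (alternating evaluation at `b_s`,
  `AlternatingCochainEvaluation`), hence a BASIS (`span_prodClass_dual_eq_top`), and `Hⁿ(G, k)` is
  spanned by the product classes `[θ_{φ(1)} ∪ ⋯ ∪ θ_{φ(n)}]`, `φ : [n] → [d]`
  (`span_prodClass_eq_top`, multilinearity);
* `scalarFiltered_pairMapₛ_of_eigencoordinates` — **torus weights on `H•(ℤ^d, k)`**: if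
  `c : X → (G →* G)` are endomorphisms with common EIGEN-COORDINATES `θ_τ ∘ c_x = e_τ(x) θ_τ`, then the
  scaled pair maps `Φ_x = Hⁿ(c_x, a_x)` admit a stable filtration of scalar type
  (`Literature.LinearAlgebra.ScalarFiltered`) with the algebraic characters
  `x ↦ a(x) ∏ᵢ e_{φ(i)}(x)`, `φ : [n] → [d]` — the general-rank version of
  `RankTwoLatticeCohomologyCharacters` [Brown1982CohomologyGroups, V §6], the computation of the
  torus action on the cohomology of the unipotent arithmetic groups `Γ ∩ U ≅ ℤ^d` of `GL₂` over a
  number field of degree `d` [Harder1987, §2, (2.4)–(2.7)].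

## References

* K. S. Brown, *Cohomology of Groups*, GTM 87 (1982), V §6, VIII §2 [Brown1982CohomologyGroups].
* G. Harder, *Eisenstein cohomology of arithmetic groups. The case GL₂*, Invent. Math. 89 (1987), §2
  [Harder1987].
-/

noncomputable section

open CategoryTheory CategoryTheory.Limits groupCohomology Literature.LinearAlgebra

universe u

/-! ### Spans of simultaneous eigenvectors are scalar-filtered -/

namespace Literature.LinearAlgebra.ScalarFiltered

variable {k : Type*} [Field k] {V : Type*} [AddCommGroup V] [Module k V] {X : Type*}
  {T : X → Module.End k V} {S : Set (X → k)}

/-- **The span of finitely many simultaneous eigenvectors with characters in `S` is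
scalar-filtered with characters `S`.** [folklore] -/
theorem span_eigenvectors {ι : Type*} [DecidableEq ι] (s : Finset ι) (w : ι → V) (χ : ι → X → k)
    (hχ : ∀ i ∈ s, χ i ∈ S) (hw : ∀ i ∈ s, ∀ x, T x (w i) = χ i x • w i) :
    ScalarFiltered T S (Submodule.span k (w '' (s : Set ι))) := by
  induction s using Finset.induction_on with
  | empty =>
    rw [Finset.coe_empty, Set.image_empty, Submodule.span_empty]
    exact bot
  | insert a s has ih =>
    have ih' := ih (fun i hi => hχ i (Finset.mem_insert_of_mem hi)) (fun i hi => hw i (Finset.mem_insert_of_mem hi))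
    have heq : Submodule.span k (w '' ((insert a s : Finset ι) : Set ι)) = (k ∙ w a) ⊔ Submodule.span k (w '' (s : Set ι)) := by
      rw [Finset.coe_insert, Set.image_insert_eq, Submodule.span_insert]
    rw [heq]
    refine step ih' le_sup_right (χ a) (hχ a (Finset.mem_insert_self a s)) fun x v hv => ?_
    obtain ⟨y, hy, z, hz, rfl⟩ := Submodule.mem_sup.1 hv
    obtain ⟨c, rfl⟩ := Submodule.mem_span_singleton.1 hy
    have h1 : T x (c • w a + z) - χ a x • (c • w a + z) = T x z - χ a x • z := by
      rw [map_add, map_smul, hw a (Finset.mem_insert_self a s) x, smul_add, smul_comm (χ a x) c (w a)]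
      abel
    rw [h1]
    exact Submodule.sub_mem _ (ih'.stable x hz) (Submodule.smul_mem _ _ hz)

/-- A scalar-filtered submodule equal to `⊤`. [folklore] -/
theorem top_of_eq {W : Submodule k V} (h : ScalarFiltered T S W) (hW : W = ⊤) : ScalarFiltered T S ⊤ :=
  hW ▸ h

end Literature.LinearAlgebra.ScalarFiltered

namespace Literature.Algebra.Homology

/-! ### The poly-ℤ chain `⟨b₁, …, bᵢ⟩` of a based free abelian group -/

section Span

variable {G : Type u} [CommGroup G] {d : ℕ} (b : Fin d → G)

/-- **`zpowSpan b i = {∏_l b_l^{m_l} : m_l = 0 for l ≥ i}`**, the subgroup generated by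
`b₀, …, b_{i-1}`. [folklore] -/
def zpowSpan (i : ℕ) : Subgroup G where
  carrier := {x | ∃ m : Fin d → ℤ, (∀ l : Fin d, i ≤ (l : ℕ) → m l = 0) ∧ x = ∏ l, b l ^ m l}
  one_mem' := ⟨0, fun _ _ => rfl, by simp⟩
  mul_mem' := by
    rintro _ _ ⟨m, hm, rfl⟩ ⟨m', hm', rfl⟩
    refine ⟨m + m', fun l hl => by simp [hm l hl, hm' l hl], ?_⟩
    rw [← Finset.prod_mul_distrib]
    exact Finset.prod_congr rfl fun l _ => by rw [Pi.add_apply, zpow_add]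
  inv_mem' := by
    rintro _ ⟨m, hm, rfl⟩
    refine ⟨-m, fun l hl => by simp [hm l hl], ?_⟩
    rw [← Finset.prod_inv_distrib]
    exact Finset.prod_congr rfl fun l _ => by rw [Pi.neg_apply, zpow_neg]

/-- Membership in `zpowSpan b i` (definitional). [folklore] -/
theorem mem_zpowSpan_iff {i : ℕ} {x : G} :
    x ∈ zpowSpan b i ↔ ∃ m : Fin d → ℤ, (∀ l : Fin d, i ≤ (l : ℕ) → m l = 0) ∧ x = ∏ l, b l ^ m l :=
  Iff.rfl

/-- `zpowSpan b 0 = 1`. [folklore] -/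
theorem zpowSpan_zero : zpowSpan b 0 = ⊥ := by
  refine (Subgroup.eq_bot_iff_forall _).2 fun x hx => ?_
  obtain ⟨m, hm, rfl⟩ := hx
  exact Finset.prod_eq_one fun l _ => by rw [hm l (Nat.zero_le _), zpow_zero]

/-- Monotonicity in `i`. [folklore] -/
theorem zpowSpan_mono {i j : ℕ} (hij : i ≤ j) : zpowSpan b i ≤ zpowSpan b j := by
  rintro _ ⟨m, hm, rfl⟩
  exact ⟨m, fun l hl => hm l (hij.trans hl), rfl⟩

/-- For `d ≤ i` every `∏ b_l^{m_l}` lies in `zpowSpan b i`; with a generating family this is `⊤`.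
[folklore] -/
theorem zpowSpan_eq_top_of_le (hgen : ∀ g : G, ∃ m : Fin d → ℤ, g = ∏ l, b l ^ m l) {i : ℕ} (hi : d ≤ i) :
    zpowSpan b i = ⊤ := by
  refine eq_top_iff.2 fun g _ => ?_
  obtain ⟨m, rfl⟩ := hgen g
  exact ⟨m, fun l hl => absurd (lt_of_lt_of_le l.2 (hi.trans hl)) (lt_irrefl _), rfl⟩

/-- `∏_l b_l^{m δ_{li}} = b_i^m`. [folklore] -/
theorem prod_zpow_single' (i : Fin d) (m : ℤ) : ∏ l, b l ^ (Pi.single i m : Fin d → ℤ) l = b i ^ m := by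
  classical
  rw [Finset.prod_eq_single i (fun l _ hl => by rw [Pi.single_eq_of_ne hl, zpow_zero])
    (fun h => absurd (Finset.mem_univ i) h), Pi.single_eq_same]

/-- `∏_l b_l^{(m + m') l} = ∏_l b_l^{m l} · ∏_l b_l^{m' l}`. [folklore] -/
theorem prod_zpow_add' (m m' : Fin d → ℤ) : ∏ l, b l ^ (m + m') l = (∏ l, b l ^ m l) * ∏ l, b l ^ m' l := by
  rw [← Finset.prod_mul_distrib]
  exact Finset.prod_congr rfl fun l _ => by rw [Pi.add_apply, zpow_add]

/-- `b_i ∈ zpowSpan b (i + 1)`. [folklore] -/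
theorem self_mem_zpowSpan_succ (i : Fin d) : b i ∈ zpowSpan b ((i : ℕ) + 1) := by
  classical
  refine ⟨Pi.single i 1, fun l hl => ?_, ?_⟩
  · have : l ≠ i := fun h => by subst h; exact Nat.lt_irrefl _ hl
    rw [Pi.single_eq_of_ne this]
  · rw [prod_zpow_single', zpow_one]

/-- **Decomposition in `zpowSpan b (i+1)`**: `x = x₀ · b_i^m` with `x₀ ∈ zpowSpan b i`. [folklore] -/
theorem exists_mem_zpowSpan_mul_zpow (i : Fin d) {x : G} (hx : x ∈ zpowSpan b ((i : ℕ) + 1)) :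
    ∃ x₀ ∈ zpowSpan b i, ∃ m : ℤ, x = x₀ * b i ^ m := by
  classical
  obtain ⟨e, he, rfl⟩ := hx
  refine ⟨∏ l, b l ^ Function.update e i 0 l, ⟨Function.update e i 0, fun l hl => ?_, rfl⟩, e i, ?_⟩
  · by_cases hli : l = i
    · subst hli; rw [Function.update_self]
    · rw [Function.update_of_ne hli]
      exact he l (by omega)
  · have hdecomp : e = Function.update e i 0 + Pi.single i (e i) := by
      ext l
      by_cases hli : l = i
      · subst hli; simp
      · simp [Function.update_of_ne hli, Pi.single_eq_of_ne hli]
    conv_lhs => rw [hdecomp]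
    rw [prod_zpow_add', prod_zpow_single']

/-- **Freeness**: for an independent family, `b_i^m ∈ zpowSpan b i` forces `m = 0`. [folklore] -/
theorem eq_zero_of_zpow_mem_zpowSpan (hind : ∀ m : Fin d → ℤ, ∏ l, b l ^ m l = 1 → m = 0) (i : Fin d)
    {m : ℤ} (hm : b i ^ m ∈ zpowSpan b i) : m = 0 := by
  classical
  obtain ⟨e, he, h⟩ := hm
  have hprod : ∏ l, b l ^ (e + -(Pi.single i m : Fin d → ℤ)) l = 1 := by
    rw [prod_zpow_add', ← h, ← Pi.single_neg, prod_zpow_single', zpow_neg, mul_inv_cancel]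
  have h0 := congrFun (hind _ hprod) i
  rw [Pi.add_apply, Pi.neg_apply, Pi.single_eq_same, he i le_rfl, zero_add, Pi.zero_apply, neg_eq_zero] at h0
  exact h0

/-- The steps `zpowSpan b i ≤ zpowSpan b (i + 1)` have infinite cyclic quotient generated by `b_i`.
[folklore] -/
theorem zpowSpan_cyclic (hind : ∀ m : Fin d → ℤ, ∏ l, b l ^ m l = 1 → m = 0) (i : ℕ) (hi : i < d) :
    ∃ t ∈ zpowSpan b (i + 1),
      (∀ g ∈ zpowSpan b (i + 1), ∃ h ∈ zpowSpan b i, ∃ n : ℤ, g = h * t ^ n) ∧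
      (∀ n : ℤ, t ^ n ∈ zpowSpan b i → n = 0) := by
  refine ⟨b ⟨i, hi⟩, self_mem_zpowSpan_succ b ⟨i, hi⟩, fun g hg => ?_, fun n hn => ?_⟩
  · obtain ⟨x₀, hx₀, m, rfl⟩ := exists_mem_zpowSpan_mul_zpow b ⟨i, hi⟩ hg
    exact ⟨x₀, hx₀, m, rfl⟩
  · exact eq_zero_of_zpow_mem_zpowSpan b hind ⟨i, hi⟩ hn

variable {k : Type u} [Field k]

/-- **`dim Hⁿ(G, A) ≤ dim A · (d choose n)`** for a commutative group `G` with a `ℤ`-basis of `d`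
elements and a finite-dimensional representation `A`. [cite: Brown1982CohomologyGroups, V §6] -/
theorem finrank_groupCohomology_le_choose (hgen : ∀ g : G, ∃ m : Fin d → ℤ, g = ∏ l, b l ^ m l)
    (hind : ∀ m : Fin d → ℤ, ∏ l, b l ^ m l = 1 → m = 0) (A : Rep k G) [FiniteDimensional k A] (n : ℕ) :
    Module.finrank k (groupCohomology A n) ≤ Module.finrank k A * Nat.choose d n := by
  have htop : zpowSpan b d = ⊤ := zpowSpan_eq_top_of_le b hgen le_rfl
  let e : zpowSpan b d ≃* G := (MulEquiv.subgroupCongr htop).trans Subgroup.topEquiv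
  rw [finrank_groupCohomology_of_mulEquiv e A n]
  exact finrank_groupCohomology_le_of_chain (zpowSpan b) (zpowSpan_zero b) d
    (fun i _ => zpowSpan_mono b (Nat.le_succ i)) (fun i _ => inferInstance)
    (fun i hi => zpowSpan_cyclic b hind i hi) (Rep.res (e : zpowSpan b d →* G) A) ‹FiniteDimensional k A› n

/-- All `Hⁿ(G, A)` are finite-dimensional for such `G` and finite-dimensional `A`. [folklore] -/
theorem finiteDimensional_groupCohomology_of_basis (hgen : ∀ g : G, ∃ m : Fin d → ℤ, g = ∏ l, b l ^ m l)
    (hind : ∀ m : Fin d → ℤ, ∏ l, b l ^ m l = 1 → m = 0) (A : Rep k G) [FiniteDimensional k A] (n : ℕ) :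
    FiniteDimensional k (groupCohomology A n) := by
  have htop : zpowSpan b d = ⊤ := zpowSpan_eq_top_of_le b hgen le_rfl
  let e : zpowSpan b d ≃* G := (MulEquiv.subgroupCongr htop).trans Subgroup.topEquiv
  have hsub : Subsingleton (zpowSpan b 0) := by
    rw [zpowSpan_zero]
    exact ⟨fun x y => Subtype.ext ((Subgroup.mem_bot.1 x.2).trans (Subgroup.mem_bot.1 y.2).symm)⟩
  have h0 : ∀ (B : Rep k (zpowSpan b 0)), Module.Finite k B → ∀ n, Module.Finite k (groupCohomology B n) :=
    fun B hB n => by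
      haveI := hB
      exact moduleFinite_groupCohomology_of_subsingleton B n
  have hd := moduleFinite_groupCohomology_of_chain (zpowSpan b) h0 d
    (fun i _ => zpowSpan_mono b (Nat.le_succ i)) (fun i _ => inferInstance) (fun i hi => zpowSpan_cyclic b hind i hi)
  exact moduleFinite_groupCohomology_of_mulEquiv e hd A n

end Span

/-! ### Dual characters -/

section Dual

variable {G : Type u} [CommGroup G] {d : ℕ} (b : Fin d → G) {k : Type u} [Field k]
  (θ : Fin d → (Additive G →+ k))

/-- The matrix `M_{τ j} = θ_τ(b_j)` of values of the characters on the basis. [folklore] -/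
def charMatrix : Matrix (Fin d) (Fin d) k :=
  Matrix.of fun τ j => θ τ (Additive.ofMul (b j))

/-- An additive character vanishing on a generating family vanishes. [folklore] -/
theorem addChar_eq_zero_of_basis (hgen : ∀ g : G, ∃ m : Fin d → ℤ, g = ∏ l, b l ^ m l)
    (Θ : Additive G →+ k) (h : ∀ j, Θ (Additive.ofMul (b j)) = 0) : Θ = 0 := by
  refine AddMonoidHom.ext fun x => ?_
  obtain ⟨m, hm⟩ := hgen x.toMul
  have hx : x = Additive.ofMul (∏ l, b l ^ m l) := by rw [← hm]; rfl
  rw [hx, ofMul_prod, map_sum, AddMonoidHom.zero_apply]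
  exact Finset.sum_eq_zero fun l _ => by rw [ofMul_zpow, map_zsmul, h l, smul_zero]

/-- **Linearly independent characters have an invertible value matrix on a basis.** [folklore] -/
theorem isUnit_det_charMatrix (hgen : ∀ g : G, ∃ m : Fin d → ℤ, g = ∏ l, b l ^ m l)
    (hθ : LinearIndependent k θ) : IsUnit (charMatrix b θ).det := by
  classical
  rw [← Matrix.isUnit_iff_isUnit_det, ← Matrix.linearIndependent_rows_iff_isUnit]
  refine Fintype.linearIndependent_iff.2 fun g hg τ => ?_
  have hΘ : (∑ σ, g σ • θ σ) = 0 := by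
    refine addChar_eq_zero_of_basis b hgen _ fun j => ?_
    have := congrFun hg j
    simpa [charMatrix, Matrix.row, AddMonoidHom.finsetSum_apply] using this
  exact Fintype.linearIndependent_iff.1 hθ g hΘ τ

/-- **The dual characters `θ'ⱼ = ∑_τ (M⁻¹)_{jτ} θ_τ`.** [folklore] -/
def dualChar (j : Fin d) : Additive G →+ k :=
  ∑ τ, (charMatrix b θ)⁻¹ j τ • θ τ

/-- `θ'ⱼ(b_l) = δ_{jl}`. [folklore] -/
theorem dualChar_apply_basis (hgen : ∀ g : G, ∃ m : Fin d → ℤ, g = ∏ l, b l ^ m l)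
    (hθ : LinearIndependent k θ) (j l : Fin d) :
    dualChar b θ j (Additive.ofMul (b l)) = if j = l then 1 else 0 := by
  classical
  have h := isUnit_det_charMatrix b θ hgen hθ
  have hmul : ((charMatrix b θ)⁻¹ * charMatrix b θ) j l = (1 : Matrix (Fin d) (Fin d) k) j l := by
    rw [Matrix.nonsing_inv_mul _ h]
  rw [Matrix.mul_apply, Matrix.one_apply] at hmul
  rw [dualChar, AddMonoidHom.finsetSum_apply, ← hmul]
  rfl

end Dual

/-! ### The eigenbasis of `Hⁿ(G, k)` -/

section Basis

variable {G : Type u} [CommGroup G] {d : ℕ} (b : Fin d → G) {k : Type u} [Field k]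
  (θ : Fin d → (Additive G →+ k))
  (hgen : ∀ g : G, ∃ m : Fin d → ℤ, g = ∏ l, b l ^ m l)
  (hind : ∀ m : Fin d → ℤ, ∏ l, b l ^ m l = 1 → m = 0) (hθ : LinearIndependent k θ)

/-- The strictly increasing enumeration of an `n`-subset. [folklore] -/
def subsetEmb {n : ℕ} (s : Finset.powersetCard n (Finset.univ : Finset (Fin d))) : Fin n ↪o Fin d :=
  (s : Finset (Fin d)).orderEmbOfFin (Finset.mem_powersetCard.1 s.2).2

/-- The enumeration ranges over the subset. [folklore] -/
theorem range_subsetEmb {n : ℕ} (s : Finset.powersetCard n (Finset.univ : Finset (Fin d))) :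
    Set.range (subsetEmb s) = ((s : Finset (Fin d)) : Set (Fin d)) :=
  Finset.range_orderEmbOfFin _ _

/-- Distinct subsets have distinct enumerations. [folklore] -/
theorem subsetEmb_injective {n : ℕ} : Function.Injective (subsetEmb (d := d) (n := n)) := by
  intro s t h
  have hr : Set.range (subsetEmb s) = Set.range (subsetEmb t) := by rw [h]
  rw [range_subsetEmb, range_subsetEmb, Finset.coe_inj] at hr
  exact Subtype.ext hr

/-- The dual product classes `[θ'_{s₁} ∪ ⋯ ∪ θ'_{sₙ}]` indexed by the `n`-subsets `s`. [folklore] -/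
def dualProdClass (n : ℕ) (s : Finset.powersetCard n (Finset.univ : Finset (Fin d))) :
    groupCohomology (trivRep k G) n :=
  prodClass fun i => dualChar b θ (subsetEmb s i)

include hgen hθ in
/-- **The dual product classes are linearly independent** (degrees `n + 1`; alternating
evaluation at `b_s` detects the coefficient of `s`). [cite: Brown1982CohomologyGroups, V §6] -/
theorem linearIndependent_dualProdClass (n : ℕ) : LinearIndependent k (dualProdClass b θ (n + 1)) := by
  classical
  refine Fintype.linearIndependent_iff.2 fun g hg s₀ => ?_
  -- the combination of cocycles is a coboundary
  have hπ : π (trivRep k G) (n + 1) (∑ s, g s • prodCocycle (fun i => dualChar b θ (subsetEmb s i))) = 0 := by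
    rw [map_sum]
    simpa only [map_smul, dualProdClass, prodClass_eq] using hg
  obtain ⟨y, hy⟩ := (groupCohomology_π_eq_zero_iff (trivRep k G) n _).1 hπ
  have hy' : inhomogeneousCochains.d (trivRep k G) n y =
      ∑ s, g s • prodCochain (fun i => dualChar b θ (subsetEmb s i)) := by
    rw [hy, map_sum]
    refine Finset.sum_congr rfl fun s _ => ?_
    rw [map_smul, iCocycles_prodCocycle]
  -- evaluate alternatingly at `b ∘ subsetEmb s₀`
  have hcomm : ∀ a c : Fin (n + 1), (b ∘ subsetEmb s₀) a * (b ∘ subsetEmb s₀) c = (b ∘ subsetEmb s₀) c * (b ∘ subsetEmb s₀) a :=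
    fun _ _ => mul_comm _ _
  have h0 := altEval_d_eq_zero (b ∘ subsetEmb s₀) hcomm y
  rw [hy', map_sum] at h0
  simp only [map_smul, smul_eq_mul] at h0
  rw [Finset.sum_eq_single s₀ (fun s _ hs => ?_) (fun h => absurd (Finset.mem_univ _) h)] at h0
  · rw [altEval_prodCochain_dual b (dualChar b θ) (dualChar_apply_basis b θ hgen hθ) (subsetEmb s₀) (subsetEmb s₀),
      if_pos rfl, mul_one] at h0
    exact h0
  · rw [altEval_prodCochain_dual b (dualChar b θ) (dualChar_apply_basis b θ hgen hθ) (subsetEmb s) (subsetEmb s₀),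
      if_neg (fun h => hs (subsetEmb_injective h)), mul_zero]

include hgen hind hθ in
/-- **The dual product classes span `Hⁿ⁺¹(G, k)`** (they are `(d choose n+1)` independent vectors in
a space of dimension `≤ (d choose n+1)`). [cite: Brown1982CohomologyGroups, V §6] -/
theorem span_dualProdClass_eq_top (n : ℕ) :
    Submodule.span k (Set.range (dualProdClass b θ (n + 1))) = ⊤ := by
  classical
  haveI : FiniteDimensional k (groupCohomology (trivRep k G) (n + 1)) :=
    finiteDimensional_groupCohomology_of_basis b hgen hind (trivRep k G) (n + 1)
  have hli := linearIndependent_dualProdClass b θ hgen hθ n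
  refine hli.span_eq_top_of_card_eq_finrank' (le_antisymm hli.fintype_card_le_finrank ?_)
  have hle := finrank_groupCohomology_le_choose b hgen hind (trivRep k G) (n + 1)
  have hA : Module.finrank k (trivRep k G) = 1 := Module.finrank_self k
  rw [hA, one_mul] at hle
  refine hle.trans (le_of_eq ?_)
  rw [Fintype.card_coe, Finset.card_powersetCard, Finset.card_univ, Fintype.card_fin]

include hgen hind hθ in
/-- **`Hⁿ(G, k)` is spanned by the product classes `[θ_{φ(1)} ∪ ⋯ ∪ θ_{φ(n)}]`, `φ : [n] → [d]`**
(multilinearity applied to the dual basis). [cite: Brown1982CohomologyGroups, V §6] -/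
theorem span_prodClass_eq_top (n : ℕ) (hn : 0 < n) :
    Submodule.span k (Set.range fun φ : Fin n → Fin d => prodClass fun i => θ (φ i)) = ⊤ := by
  classical
  obtain ⟨m, rfl⟩ : ∃ m, n = m + 1 := ⟨n - 1, by omega⟩
  refine eq_top_iff.2 ?_
  rw [← span_dualProdClass_eq_top b θ hgen hind hθ m, Submodule.span_le]
  rintro _ ⟨s, rfl⟩
  have hexp : dualProdClass b θ (m + 1) s =
      ∑ φ : Fin (m + 1) → Fin d, (∏ i, (charMatrix b θ)⁻¹ (subsetEmb s i) (φ i)) • prodClass fun i => θ (φ i) :=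
    prodClass_sum_smul θ fun i τ => (charMatrix b θ)⁻¹ (subsetEmb s i) τ
  rw [hexp]
  exact Submodule.sum_mem _ fun φ _ => Submodule.smul_mem _ _ (Submodule.subset_span ⟨φ, rfl⟩)

end Basis

/-! ### Torus weights on `H•(ℤ^d, k)` -/

section Weights

variable {G : Type u} [CommGroup G] {d : ℕ} (b : Fin d → G) {k : Type u} [Field k]
  (θ : Fin d → (Additive G →+ k))
  (hgen : ∀ g : G, ∃ m : Fin d → ℤ, g = ∏ l, b l ^ m l)
  (hind : ∀ m : Fin d → ℤ, ∏ l, b l ^ m l = 1 → m = 0) (hθ : LinearIndependent k θ)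
  {X : Type*} (c : X → (G →* G)) (e : Fin d → X → k) (a : X → k)
  (he : ∀ τ x, precompHom (c x) (θ τ) = e τ x • θ τ)

/-- The algebraic characters `x ↦ a(x) ∏ᵢ e_{φ(i)}(x)`, `φ : [n] → [d]`. [cite: Harder1987, §2] -/
def weightCharSet (n : ℕ) : Set (X → k) :=
  {χ | ∃ φ : Fin n → Fin d, χ = fun x => a x * ∏ i, e (φ i) x}

include hgen hind hθ he in
/-- **Torus weights on `H•(ℤ^d, k)`.**  For a commutative group `G` with a `ℤ`-basis of `d`
elements, linearly independent additive characters `θ₁, …, θ_d` which are common eigen-coordinates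
of the endomorphisms `c_x` (`θ_τ ∘ c_x = e_τ(x) θ_τ`), the scaled pair maps `Φ_x = Hⁿ(c_x, a_x)` on
`Hⁿ(G, k)` have a stable filtration of scalar type with the characters `x ↦ a(x) ∏ᵢ e_{φ(i)}(x)`,
`φ : [n] → [d]` (indeed `Hⁿ(G, k)` has the eigenbasis of product classes).
[cite: Harder1987, §2, (2.4)–(2.7)] [cite: Brown1982CohomologyGroups, V §6] -/
theorem scalarFiltered_pairMapₛ_of_eigencoordinates (n : ℕ) :
    ScalarFiltered (fun x => pairMapₛ (k := k) (c x) (a x) n) (weightCharSet e a n) ⊤ := by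
  classical
  rcases Nat.eq_zero_or_pos n with rfl | hn
  · refine (scalarFiltered_H0ₛ c a).mono ?_
    rintro χ rfl
    exact ⟨Fin.elim0, funext fun x => by simp⟩
  · have hspan := span_prodClass_eq_top b θ hgen hind hθ n hn
    have h := ScalarFiltered.span_eigenvectors (T := fun x => pairMapₛ (k := k) (c x) (a x) n)
      (S := weightCharSet e a n) (Finset.univ : Finset (Fin n → Fin d))
      (fun φ => prodClass fun i => θ (φ i)) (fun φ x => a x * ∏ i, e (φ i) x)
      (fun φ _ => ⟨φ, rfl⟩) (fun φ _ x => pairMapₛ_prodClass_of_eigen (c x) (a x) _ (fun i => e (φ i) x)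
        fun i => he (φ i) x)
    refine h.top_of_eq ?_
    rw [← hspan, Finset.coe_univ, Set.image_univ]

end Weights

end Literature.Algebra.Homology

end
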